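import Summits.Ventures.HodgeRepro.TwistedQuadGen

/-!
# Coordinates on the model groups `ℤ/m ⋊_s ℤ/2` (the toolkit for the general-`k` twisted rectangle)

Blind re-derivation cell `pub-hodge-repro`, seat `p1` (gen 12).  `TwistedQuadGen.lean` decides the twisted rectangle
on one model at a time; to prove route-2's Theorem T (i) for EVERY even `k ≥ 4` (`TwistedQuadAllPos.lean`,
`TwistedQuadAllNeg.lean`) the local conditions must be computed symbolically.  This file writes every element of
`TwistGroup m s` as `mk a g = ⟨ofAdd a, ofAdd g⟩` (`a ∈ ℤ/m`, `g ∈ ℤ/2`) and records the multiplication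
`mk a g * mk b h = mk (a + s^g b) (g + h)`, the inverses of the four twists `1, u, v, vu`, the products
`mk a g * t⁻¹` and `mk a g * c` in coordinates, the value of `m/2` in `ℤ/m` and the `ℤ/m`-arithmetic of `val`
needed downstream (`val_natCast_lt`, `val_natCast_sub`).  Everything is generic in `m` and `s`; nothing is decided.
-/

set_option autoImplicit false

open Finset Multiplicative
open scoped Pointwise

namespace HodgeRepro.TwistedQuadGen

open HodgeRepro.CosetQuad

variable (m : ℕ) [NeZero m] (s : ZMod m) (hs : s * s = 1)

/-- The element `(a, g)` of the model group. -/
def mk (a : ZMod m) (g : ZMod 2) : TwistGroup m s hs := ⟨ofAdd a, ofAdd g⟩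

omit [NeZero m] in
/-- The action of `ofAdd g` on `ofAdd b`: multiplication by `s^g`. -/
theorem twistPhi_ofAdd_apply (g : ZMod 2) (b : ZMod m) :
    (twistPhi m s hs (ofAdd g)) (ofAdd b) = ofAdd (s ^ g.val * b) := by
  rcases (show ∀ y : ZMod 2, y = 0 ∨ y = 1 by decide) g with rfl | rfl
  · rw [twistPhi_zero, MulAut.one_apply, ZMod.val_zero, pow_zero, one_mul]
  · rw [twistPhi_one, twistAut_apply, toAdd_ofAdd, val_one_two, pow_one]

omit [NeZero m] in
/-- Multiplication in coordinates. -/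
theorem mk_mul (a b : ZMod m) (g h : ZMod 2) :
    mk m s hs a g * mk m s hs b h = mk m s hs (a + s ^ g.val * b) (g + h) := by
  refine SemidirectProduct.ext ?_ ?_
  · show ofAdd a * (twistPhi m s hs (ofAdd g)) (ofAdd b) = ofAdd (a + s ^ g.val * b)
    rw [twistPhi_ofAdd_apply, ← ofAdd_add]
  · show ofAdd g * ofAdd h = ofAdd (g + h)
    rw [← ofAdd_add]

omit [NeZero m] in
/-- `1 = mk 0 0`. -/
theorem one_eq_mk : (1 : TwistGroup m s hs) = mk m s hs 0 0 := rfl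

omit [NeZero m] in
/-- `v = mk 1 0`. -/
theorem tv_eq_mk : tv m s hs = mk m s hs 1 0 := rfl

omit [NeZero m] in
/-- `u = mk 0 1`. -/
theorem tu_eq_mk : tu m s hs = mk m s hs 0 1 := rfl

omit [NeZero m] in
/-- `c = mk (m/2) 0`. -/
theorem tc_eq_mk : tc m s hs = mk m s hs ((m / 2 : ℕ) : ZMod m) 0 := rfl

/-- `1 + 1 = 0` in `ℤ/2`. -/
theorem two_zmod_two : (1 : ZMod 2) + 1 = 0 := by decide

omit [NeZero m] in
/-- `u⁻¹ = u`. -/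
theorem tu_inv : (tu m s hs)⁻¹ = mk m s hs 0 1 := by
  rw [tu_eq_mk]
  apply inv_eq_of_mul_eq_one_right
  rw [mk_mul, mul_zero, add_zero, two_zmod_two, one_eq_mk]

omit [NeZero m] in
/-- `v⁻¹ = mk (−1) 0`. -/
theorem tv_inv : (tv m s hs)⁻¹ = mk m s hs (-1) 0 := by
  rw [tv_eq_mk]
  apply inv_eq_of_mul_eq_one_right
  rw [mk_mul, ZMod.val_zero, pow_zero, one_mul, add_neg_cancel, add_zero, one_eq_mk]

omit [NeZero m] in
/-- `(v u)⁻¹ = mk (−s) 1`. -/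
theorem tvtu_inv : (tv m s hs * tu m s hs)⁻¹ = mk m s hs (-s) 1 := by
  rw [tv_eq_mk, tu_eq_mk, mk_mul, ZMod.val_zero, pow_zero, one_mul, add_zero, zero_add]
  apply inv_eq_of_mul_eq_one_right
  rw [mk_mul, val_one_two, pow_one, mul_neg, hs, add_neg_cancel, two_zmod_two, one_eq_mk]

omit [NeZero m] in
/-- The four inverses of the twisted rectangle in coordinates. -/
theorem rectT_inv (i : Fin 4) :
    (rectT m s hs i)⁻¹ = ![mk m s hs 0 0, mk m s hs 0 1, mk m s hs (-1) 0, mk m s hs (-s) 1] i := by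
  fin_cases i
  · show (1 : TwistGroup m s hs)⁻¹ = mk m s hs 0 0
    rw [inv_one, one_eq_mk]
  · exact tu_inv m s hs
  · exact tv_inv m s hs
  · exact tvtu_inv m s hs

include hs in
omit [NeZero m] in
/-- `s^g · s = s^(1 − g)`: `s` for `g = 0`, `1` for `g = 1`. -/
theorem pow_val_mul_self (g : ZMod 2) : s ^ g.val * s = s ^ (1 - g).val := by
  rcases (show ∀ y : ZMod 2, y = 0 ∨ y = 1 by decide) g with rfl | rfl
  · rw [ZMod.val_zero, pow_zero, one_mul, sub_zero, val_one_two, pow_one]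
  · rw [val_one_two, pow_one, hs, sub_self, ZMod.val_zero, pow_zero]

omit [NeZero m] in
/-- The products `mk a g * (rectT i)⁻¹` in coordinates. -/
theorem mk_mul_rectT_inv (a : ZMod m) (g : ZMod 2) (i : Fin 4) :
    mk m s hs a g * (rectT m s hs i)⁻¹ =
      ![mk m s hs a g, mk m s hs a (g + 1), mk m s hs (a - s ^ g.val) g,
        mk m s hs (a - s ^ (1 - g).val) (g + 1)] i := by
  rw [rectT_inv]
  fin_cases i
  · show mk m s hs a g * mk m s hs 0 0 = mk m s hs a g
    rw [mk_mul, mul_zero, add_zero, add_zero]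
  · show mk m s hs a g * mk m s hs 0 1 = mk m s hs a (g + 1)
    rw [mk_mul, mul_zero, add_zero]
  · show mk m s hs a g * mk m s hs (-1) 0 = mk m s hs (a - s ^ g.val) g
    rw [mk_mul, mul_neg, mul_one, ← sub_eq_add_neg, add_zero]
  · show mk m s hs a g * mk m s hs (-s) 1 = mk m s hs (a - s ^ (1 - g).val) (g + 1)
    rw [mk_mul, mul_neg, ← sub_eq_add_neg, pow_val_mul_self m s hs]

omit [NeZero m] in
/-- `mk a g * c = mk (a + s^g (m/2)) g`. -/
theorem mk_mul_tc (a : ZMod m) (g : ZMod 2) :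
    mk m s hs a g * tc m s hs = mk m s hs (a + s ^ g.val * ((m / 2 : ℕ) : ZMod m)) g := by
  rw [tc_eq_mk, mk_mul, add_zero]

omit [NeZero m] in
/-- `mk a g * 1⁻¹ = mk a g`. -/
theorem mk_mul_rectT_inv_zero (a : ZMod m) (g : ZMod 2) : mk m s hs a g * (rectT m s hs 0)⁻¹ = mk m s hs a g :=
  mk_mul_rectT_inv m s hs a g 0

omit [NeZero m] in
/-- `mk a g * u⁻¹ = mk a (g + 1)`. -/
theorem mk_mul_rectT_inv_one (a : ZMod m) (g : ZMod 2) :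
    mk m s hs a g * (rectT m s hs 1)⁻¹ = mk m s hs a (g + 1) :=
  mk_mul_rectT_inv m s hs a g 1

omit [NeZero m] in
/-- `mk a g * v⁻¹ = mk (a − s^g) g`. -/
theorem mk_mul_rectT_inv_two (a : ZMod m) (g : ZMod 2) :
    mk m s hs a g * (rectT m s hs 2)⁻¹ = mk m s hs (a - s ^ g.val) g :=
  mk_mul_rectT_inv m s hs a g 2

omit [NeZero m] in
/-- `mk a g * (vu)⁻¹ = mk (a − s^(1−g)) (g + 1)`. -/
theorem mk_mul_rectT_inv_three (a : ZMod m) (g : ZMod 2) :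
    mk m s hs a g * (rectT m s hs 3)⁻¹ = mk m s hs (a - s ^ (1 - g).val) (g + 1) :=
  mk_mul_rectT_inv m s hs a g 3

/-! ### `val` arithmetic in `ℤ/m` -/

omit [NeZero m] in
/-- `(n : ℤ/m).val = n` for `n < m`. -/
theorem val_natCast_lt {n : ℕ} (h : n < m) : ((n : ℕ) : ZMod m).val = n := by
  rw [ZMod.val_natCast, Nat.mod_eq_of_lt h]

omit [NeZero m] in
/-- `(n : ℤ/m).val = n − m` for `m ≤ n < 2m`. -/
theorem val_natCast_sub {n : ℕ} (h1 : m ≤ n) (h2 : n < 2 * m) : ((n : ℕ) : ZMod m).val = n - m := by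
  rw [ZMod.val_natCast, Nat.mod_eq_sub_mod h1, Nat.mod_eq_of_lt (by omega)]

/-- Every `a ∈ ℤ/m` is the cast of its value. -/
theorem eq_natCast_val (a : ZMod m) : a = ((a.val : ℕ) : ZMod m) := (ZMod.natCast_zmod_val a).symm

end HodgeRepro.TwistedQuadGen
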